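import Literature.AlgebraicGeometry.ShimuraVarieties.KudlaRapoportYang2006.Ch3RamifiedResidueFieldsHolds
import Literature.NumberTheory.Automorphic.ShimuraCurveIdealsPrincipal
import Literature.NumberTheory.Automorphic.ShimuraCurveDataExistence
import Literature.NumberTheory.Automorphic.MatrixOrderRatLattice
import Literature.NumberTheory.Automorphic.BrandtDataRingEquiv
import Literature.NumberTheory.Automorphic.BrandtModuleLocal
import Literature.NumberTheory.Automorphic.BrandtXiSetupIndependence
import Literature.NumberTheory.Automorphic.QuaternionAlgebraEmbeddingHolds
import Literature.NumberTheory.QuadraticForms.HilbertSymbolRatOdd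
import Literature.NumberTheory.NumberFields.AdicCompletionSquareCriteria
import HarnessLib

/-!
# [KudlaRapoportYang2006, §3.4 Remark 3.4.7 (p. 55)] «there is an element `δ ∈ O_B` such that `δ² = -D(B)`» —
# DISCHARGED: `KRY2006_3_4_7_exists_delta_holds`

Kernel-lane companion of the statement carpet ★
`Literature/AlgebraicGeometry/ShimuraVarieties/KudlaRapoportYang2006/Ch3CyclesShimuraCurvesI.lean` (squad TKR): its named
fact ★ `KRY2006_3_4_7_exists_delta` — S. Kudla, M. Rapoport, T. Yang, *Modular Forms and Special Cycles on Shimura Curves*,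
Ann. of Math. Stud. 161 (2006), Ch. 3 §3.4 Remark 3.4.7 (p. 55): «Recall that there is an element `δ ∈ O_B` such that
`δ² = -D(B)`» — for `B` an indefinite quaternion algebra over `ℚ` and `O_B` a maximal order — is PROVED here.  THEOREMS
ONLY (no definition, no named fact, no `sorry`, no instance, no notation); cell hodgecm-mathlib, seat B-typ03 (g34); net
debt −1.  HONEST LABEL: HC_CM is proved only modulo the 7 printed citations (2 remaining named inputs: hLiu418, h413)
until rung 0 closes; this file is off that cone and adds no citation debt.

## The proof (the classical one, assembled from results the tree already holds)

For `D(B) > 1`: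
1. **`ℚ(√-D(B))` embeds in `B`** (Vignéras III §3 Thm. 3.8, ★ `exists_sq_eq_of_not_isSquare_ramified_holds`): `-D(B)` is
   not a square in `ℚ_p` for `p ∣ D(B)` (odd valuation, `D(B)` squarefree — `not_isSquare_adicCompletion_neg_disc`) and
   `B` has no ramified infinite place; so some `y ∈ B` has `y² = -D(B)`.
2. **`y` lies in a maximal order `O₁`** (Vignéras I §4 Prop. 4.2): `y` stabilises the full lattice `M = O_B + y O_B`
   (`y² ∈ ℤ`), so `y ∈ O_ℓ(M)`, an order (★ `Brandt.isOrder_leftOrder`), contained in a maximal order (★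
   `Brandt.IsOrder.exists_isMaximalOrder_ge'`).
3. **`O₁` is conjugate to `O_B`** (type number one; Vignéras III §5 Thm. 5.7 ∕ Cor. 5.7 with I §4 Lemme 4.10): the two
   maximal orders are tied by an invertible right `O_B`-ideal `I` with `O_ℓ(I) = O₁` (★
   `IsEichlerOrder.exists_isInvertibleRightIdeal_leftOrderOf_eq`); after scaling `I ⊆ O_B`, Eichler's theorem (★
   `ShimuraCurveData.exists_eq_units_smul_of_pos`, on a `Type`-small model packaged as a Shimura curve datum
   `ShimuraCurveData (disc B) 1` exactly as in ★ `nonempty_shimuraCurveData_holds`) gives `I = βO_B`, hence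
   `O₁ = O_ℓ(βO_B) = β O_B β⁻¹` and `δ = β⁻¹ y β ∈ O_B`, `δ² = -D(B)`.
For `D(B) = 1`: `B ≃ M₂(ℚ)` (★ `nonempty_algEquiv_of_ramifiedPlaces_eq_holds`), `O_B ↦ g M₂(ℤ) g⁻¹` (★
`Brandt.IsMaximalOrder.exists_eq_map_unitsConj_matrixOrder`), `δ = g·((0, -1), (1, 0))·g⁻¹`.

## References
* [KudlaRapoportYang2006] S. Kudla, M. Rapoport, T. Yang, Modular Forms and Special Cycles on Shimura Curves, Ann. of Math.
  Stud. 161, Princeton 2006, Ch. 3 §3.4 Remark 3.4.7, p. 55.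
* [VignerasLNM800] M.-F. Vignéras, Arithmétique des algèbres de quaternions, LNM 800 (1980), Ch. I §4 Prop. 4.2, Lemme 4.10;
  Ch. II §2 Lemme 2.1; Ch. III §3 Thm. 3.1, Thm. 3.8; §5 Thm. 5.7 (pp. 21, 77 of the held copy).
-/

set_option autoImplicit false

noncomputable section

open NumberField IsDedekindDomain
open Literature.NumberTheory.Automorphic
open Literature.NumberTheory.QuadraticForms
open Literature.NumberTheory.NumberFields
open scoped Quaternion TensorProduct Pointwise

namespace Literature.AlgebraicGeometry.ShimuraVarieties.KudlaRapoportYang2006.Ch3CyclesShimuraCurvesI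

universe u v

/-! ### Step 1: `-D(B)` is not a square at the primes dividing `D(B)` -/

/-- `-D(B)` is not a square in `ℚ_p` for `p ∣ D(B)`: `D(B)` is squarefree, so `ord_p(-D(B)) = 1` is odd. [folklore] -/
private theorem not_isSquare_adicCompletion_neg_disc {B : Type u} [Ring B] [Algebra ℚ B] [IsQuaternionAlgebra ℚ B]
    (v : HeightOneSpectrum (𝓞 ℚ)) (hv : ((Rat.HeightOneSpectrum.primesEquiv v : Nat.Primes) : ℕ) ∣ disc B) :
    ¬ IsSquare (algebraMap ℚ (v.adicCompletion ℚ) (-(disc B : ℚ))) := by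
  have hp : (Rat.HeightOneSpectrum.natGenerator v).Prime := Rat.HeightOneSpectrum.prime_natGenerator v
  have hD0 : (-(disc B : ℚ)) ≠ 0 := neg_ne_zero.2 (by exact_mod_cast disc_ne_zero B)
  refine not_isSquare_adicCompletion_of_odd_log_valuation v hD0 ?_
  obtain ⟨m, hm⟩ := hv
  change disc B = Rat.HeightOneSpectrum.natGenerator v * m at hm
  have hpm : ¬ Rat.HeightOneSpectrum.natGenerator v ∣ m := fun h =>
    not_sq_dvd_disc B hp (hm ▸ mul_dvd_mul_left _ h)
  have hm1 : v.intValuation (m : 𝓞 ℚ) = 1 := by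
    rw [HeightOneSpectrum.intValuation_eq_one_iff, ← Int.cast_natCast, RatPlace.intCast_mem_asIdeal_iff,
      Int.natCast_dvd_natCast]
    exact hpm
  rw [Valuation.map_neg, show (disc B : ℚ) = algebraMap (𝓞 ℚ) ℚ
      (((Rat.HeightOneSpectrum.natGenerator v : ℕ) : 𝓞 ℚ) * (m : 𝓞 ℚ)) by
        rw [map_mul, map_natCast, map_natCast, hm, Nat.cast_mul],
    HeightOneSpectrum.valuation_of_algebraMap, map_mul, RatPlace.intValuation_natGenerator, hm1, mul_one,
    WithZero.log_exp]
  decide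

/-- **Step 1**: an indefinite quaternion algebra `B` over `ℚ` contains `y` with `y² = -D(B)` (the imaginary quadratic field
`ℚ(√-D(B))` embeds: Vignéras III §3 Thm. 3.8 — `-D(B)` is a non-square at every ramified place).
[cite: VignerasLNM800, Ch. III §3 Thm. 3.8] -/
theorem exists_mul_self_eq_neg_disc {B : Type u} [Ring B] [Algebra ℚ B] [IsQuaternionAlgebra ℚ B]
    (hind : IsIndefinite B) : ∃ y : B, y * y = algebraMap ℚ B (-(disc B : ℚ)) := by
  refine exists_sq_eq_of_not_isSquare_ramified_holds ℚ B (-(disc B : ℚ)) ?_ ?_ ?_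
  · rintro ⟨r, hr⟩
    have h0 : (0 : ℚ) < disc B := by exact_mod_cast Nat.pos_of_ne_zero (disc_ne_zero B)
    nlinarith [mul_self_nonneg r]
  · intro v hv
    haveI : Fact (((Rat.HeightOneSpectrum.primesEquiv v : Nat.Primes) : ℕ)).Prime :=
      ⟨(Rat.HeightOneSpectrum.primesEquiv v).2⟩
    refine not_isSquare_adicCompletion_neg_disc v ?_
    have h := (isDivisionAt_iff_not_isSplitAt B _ v rfl).2 hv
    rw [← mem_primeFactors_disc_iff B, Nat.mem_primeFactors_of_ne_zero (disc_ne_zero B)] at h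
    exact h.2
  · intro w hw
    obtain ⟨e'⟩ := hind
    rw [ramifiedInfinitePlaces_eq_empty_of_algHom_real
      ((e'.restrictScalars ℚ).toAlgHom.comp (ScalarExtension.incl ℚ ℝ B))] at hw
    exact hw.elim

/-! ### Step 2: an integral element lies in a maximal order -/

/-- **Step 2** (Vignéras I §4 Prop. 4.2): if `y² = c ∈ ℤ` (as a scalar) then `y` lies in some maximal order — `y`
stabilises the full lattice `M = O + yO` for any order `O`, so `y ∈ O_ℓ(M)`, an order contained in a maximal one.
[cite: VignerasLNM800, Ch. I §4 Prop. 4.2 (p. 21 of the held copy)] -/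
theorem exists_isMaximalOrder_mem_of_mul_self_eq {H : Type v} [Ring H] [Algebra ℚ H] [IsQuaternionAlgebra ℚ H]
    (hdiv : ∀ x : H, x ≠ 0 → IsUnit x) {O : Submodule ℤ H} (hO : Brandt.IsOrder H O) {y : H} {c : ℤ}
    (hy : y * y = algebraMap ℚ H c) (hc : c ≠ 0) :
    ∃ O₁ : Submodule ℤ H, Brandt.IsMaximalOrder H O₁ ∧ y ∈ O₁ := by
  haveI : IsAddTorsionFree H := isAddTorsionFree_of_charZero_module ℚ H
  haveI : Nontrivial H :=
    Module.nontrivial_of_finrank_pos (R := ℚ) (by rw [IsQuaternionAlgebra.finrank_eq_four (K := ℚ) (D := H)]; omega)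
  have hy0 : y ≠ 0 := by
    intro h
    rw [h, zero_mul, eq_comm, map_eq_zero_iff _ (algebraMap ℚ H).injective, Int.cast_eq_zero] at hy
    exact hc hy
  obtain ⟨yU, hyU⟩ : ∃ yU : Hˣ, (yU : H) = y := ⟨(hdiv y hy0).unit, rfl⟩
  -- the lattice `M = O + yO`
  set M : Submodule ℤ H := O ⊔ yU • O with hM
  have hMfull : IsFullLattice H M :=
    ⟨hO.isFullLattice.1.sup (hO.isFullLattice.units_smul yU).1, fun d => by
      obtain ⟨n, hn, hnd⟩ := hO.isFullLattice.2 d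
      exact ⟨n, hn, Submodule.mem_sup_left hnd⟩⟩
  have hO₂ : Brandt.IsOrder H (Brandt.leftOrder M) := Brandt.isOrder_leftOrder hMfull
  -- `y M ⊆ M`
  have hyM : y ∈ Brandt.leftOrder M := by
    intro m hm
    obtain ⟨o₁, ho₁, o₂, ho₂, rfl⟩ := Submodule.mem_sup.1 hm
    rw [mem_units_smul_submodule_iff, Units.smul_def, smul_eq_mul] at ho₂
    rw [mul_add]
    refine Submodule.add_mem _ (Submodule.mem_sup_right ?_) (Submodule.mem_sup_left ?_)
    · rw [mem_units_smul_submodule_iff, Units.smul_def, smul_eq_mul, hyU.symm, Units.inv_mul_cancel_left]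
      exact ho₁
    · have h : y * o₂ = (c : ℤ) • (((yU⁻¹ : Hˣ) : H) * o₂) := by
        rw [← Int.cast_smul_eq_zsmul ℚ, Algebra.smul_def, ← hy, ← hyU, mul_assoc, Units.mul_inv_cancel_left]
      rw [h]
      exact Submodule.smul_mem _ _ ho₂
  obtain ⟨O₁, hO₁, hle⟩ := hO₂.exists_isMaximalOrder_ge'
  exact ⟨O₁, hO₁, hle hyM⟩

/-! ### Step 3: type number one, through Eichler's theorem on a Shimura curve datum -/

/-- Scalars act trivially by conjugation on lattices: `c • (op c⁻¹ • L) = L` for `c ∈ ℚ^×`. [folklore] -/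
private theorem units_smul_op_smul_eq_of_algebraMap {H : Type v} [Ring H] [Algebra ℚ H] (c : ℚˣ) (L : Submodule ℤ H) :
    Units.map (algebraMap ℚ H : ℚ →* H) c •
        (MulOpposite.op (((Units.map (algebraMap ℚ H : ℚ →* H) c)⁻¹ : Hˣ) : H) • L) = L := by
  ext x
  rw [mem_units_smul_submodule_iff, mem_op_units_smul_submodule_iff, inv_inv, Units.smul_def, smul_eq_mul,
    Units.coe_map, MonoidHom.coe_coe, ← map_inv, Units.coe_map, MonoidHom.coe_coe, mul_assoc,
    ← Algebra.commutes, ← mul_assoc, ← map_mul, Units.inv_mul, map_one, one_mul]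

/-- **Step 3 on a Shimura curve datum** (type number one; Vignéras III §5 Thm. 5.7 ∕ Cor. 5.7 with I §4 Lemme 4.10 «deux
ordres sont du même type si et seulement s'ils sont liés par un idéal principal»): for `X : ShimuraCurveData D M` with `D > 1`
and any Eichler order `O₁` of level `M` of `X.B`, there is a unit `β` with `x ∈ O₁ ↔ β⁻¹ x β ∈ X.O`.
[cite: VignerasLNM800, Ch. I §4 Lemme 4.10 and Ch. III §5 Thm. 5.7 (p. 77 of the held copy)] -/
theorem exists_forall_mem_iff_conj_mem_of_shimuraCurveData {D M : ℕ} (X : ShimuraCurveData D M) (hD : 1 < D)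
    (hM : 0 < M) {O₁ : Submodule ℤ X.B} (hO₁ : Brandt.IsEichlerOrder X.B O₁ M) :
    ∃ β : (X.B)ˣ, ∀ x : X.B, x ∈ O₁ ↔ ((β⁻¹ : (X.B)ˣ) : X.B) * x * β ∈ X.O := by
  classical
  haveI := X.nontrivial_B
  have hdiv : ∀ x : X.B, x ≠ 0 → IsUnit x := fun x hx => X.isUnit_of_ne_zero hD x hx
  have hO := X.isOrder
  have hZO := X.isZOrder
  -- a connecting ideal `I`: invertible right `O`-ideal with left order `O₁`
  obtain ⟨I, hI, hIO₁⟩ := IsEichlerOrder.exists_isInvertibleRightIdeal_leftOrderOf_eq hdiv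
    (isEichlerOrder_iff_brandt.mpr X.isEichlerOrder) (isEichlerOrder_iff_brandt.mpr hO₁) hM.ne'
  -- scale it into `O`
  obtain ⟨n, hn0, hnI⟩ := exists_smul_mem_of_fg hO.isFullLattice hI.isFullLattice.1
  set c : (X.B)ˣ := Units.map (algebraMap ℚ X.B : ℚ →* X.B) (Units.mk0 (n : ℚ) (Int.cast_ne_zero.2 hn0)) with hc
  have hcval : (c : X.B) = algebraMap ℚ X.B n := rfl
  have hI' : IsInvertibleRightIdeal X.O (c • I) := hI.units_smul c
  have hI'O : c • I ≤ X.O := by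
    intro z hz
    rw [mem_units_smul_submodule_iff] at hz
    have h := hnI _ hz
    rwa [← Int.cast_smul_eq_zsmul ℚ, Algebra.smul_def, ← hcval, ← smul_eq_mul, ← Units.smul_def, smul_inv_smul]
      at h
  have hleft : leftOrderOf (c • I) = O₁ := by
    rw [leftOrderOf_units_smul, hIO₁, hc, units_smul_op_smul_eq_of_algebraMap]
  -- Eichler: `cI = βO`, so `O₁ = O_ℓ(βO) = β O β⁻¹`
  obtain ⟨β, -, -, hIβ⟩ := X.exists_eq_units_smul_of_pos hD hM hI' hI'O
  refine ⟨β, fun x => ?_⟩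
  rw [← hleft, hIβ, leftOrderOf_units_smul, hZO.leftOrderOf_eq, mem_units_smul_submodule_iff,
    mem_op_units_smul_submodule_iff, inv_inv, Units.smul_def, smul_eq_mul]

/-! ### Transport along a model `B ≃ B'` -/

/-- An element `δ` with `δ² = c` of the transported order `e(O)` comes from one of `O`. [folklore] -/
private theorem exists_delta_of_algEquiv {B : Type u} [Ring B] [Algebra ℚ B] {B' : Type v} [Ring B'] [Algebra ℚ B']
    (e : B ≃ₐ[ℚ] B') {O : Submodule ℤ B} {δ : B'} {c : ℚ}
    (hδ : δ ∈ O.map ((e : B ≃+* B').toAddEquiv.toIntLinearEquiv : B →ₗ[ℤ] B'))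
    (hδδ : δ * δ = algebraMap ℚ B' c) : ∃ d ∈ O, d * d = algebraMap ℚ B c := by
  have key : ∀ y, (e : B ≃+* B').symm y = e.symm y := fun _ => rfl
  refine ⟨e.symm δ, ?_, ?_⟩
  · rw [← key]; exact (mem_map_ringEquiv_iff _).1 hδ
  · rw [← map_mul, hδδ, AlgEquiv.commutes]

/-! ### `D(B) > 1` -/

/-- **`D(B) > 1`**: for `B` an indefinite quaternion algebra over `ℚ` with `D(B) > 1` and `O_B` a maximal order, some
`δ ∈ O_B` has `δ² = -D(B)` (steps 1–3 above on a `Type`-small model packaged as a Shimura curve datum of level `1`).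
[cite: KudlaRapoportYang2006, §3.4 Remark 3.4.7 (p. 55)] [cite: VignerasLNM800, Ch. III §3 Thm. 3.8 and §5 Thm. 5.7] -/
theorem exists_delta_of_one_lt_disc {B : Type u} [Ring B] [Algebra ℚ B] [IsQuaternionAlgebra ℚ B]
    (hind : IsIndefinite B) {O : Submodule ℤ B} (hmax : Brandt.IsMaximalOrder B O) (hD : 1 < disc B) :
    ∃ δ ∈ O, δ * δ = algebraMap ℚ B (-(disc B : ℚ)) := by
  classical
  haveI : NeZero (2 : ℚ) := ⟨two_ne_zero⟩
  -- step 1 in `B`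
  obtain ⟨y, hy⟩ := exists_mul_self_eq_neg_disc hind
  -- a `Type`-small model and the transported maximal order
  obtain ⟨a, b, ha, hb, ⟨e⟩⟩ := IsQuaternionAlgebra.exists_algEquiv_quaternionAlgebra (K := ℚ) (D := B)
  haveI hQ : IsQuaternionAlgebra ℚ ℍ[ℚ,a,b] := QuaternionAlgebra.isQuaternionAlgebra_holds ha hb
  set O₀ : Submodule ℤ ℍ[ℚ,a,b] :=
    O.map ((e : B ≃+* ℍ[ℚ,a,b]).toAddEquiv.toIntLinearEquiv : B →ₗ[ℤ] ℍ[ℚ,a,b]) with hO₀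
  have hmax₀ : Brandt.IsMaximalOrder ℍ[ℚ,a,b] O₀ := hmax.map_ringEquiv (e : B ≃+* ℍ[ℚ,a,b])
  have hEich : Brandt.IsEichlerOrder ℍ[ℚ,a,b] O₀ 1 :=
    ⟨O₀, O₀, hmax₀, hmax₀, (inf_idem O₀).symm, AddSubgroup.relIndex_self _⟩
  -- ramification of the model
  have hsq : Squarefree (disc B) :=
    Nat.squarefree_iff_prime_squarefree.mpr fun p hp => not_sq_dvd_disc B hp
  have hram : ramifiedPlaces ℚ ℍ[ℚ,a,b] =
      {v | ((Rat.HeightOneSpectrum.primesEquiv v : Nat.Primes) : ℕ) ∣ disc B} := by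
    ext v
    haveI hp : Fact (((Rat.HeightOneSpectrum.primesEquiv v : Nat.Primes) : ℕ)).Prime :=
      ⟨(Rat.HeightOneSpectrum.primesEquiv v).2⟩
    rw [Set.mem_setOf_eq, mem_ramifiedPlaces_iff, ← isSplitAt_congr ℚ B e v,
      ← isDivisionAt_iff_not_isSplitAt B _ v rfl, ← mem_primeFactors_disc_iff B,
      Nat.mem_primeFactors_of_ne_zero (disc_ne_zero B)]
    exact ⟨fun h => h.2, fun h => ⟨hp.out, h⟩⟩
  -- the real splitting, the embedding `ι`, the Fuchsian group and a fundamental domain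
  obtain ⟨e'⟩ := hind
  let E : ℝ ⊗[ℚ] ℍ[ℚ,a,b] ≃ₐ[ℝ] Matrix (Fin 2) (Fin 2) ℝ :=
    (Algebra.TensorProduct.congr (AlgEquiv.refl : ℝ ≃ₐ[ℝ] ℝ) e.symm).trans
      ((ScalarExtension.ofTensor ℚ ℝ B).trans e')
  let ι : ℍ[ℚ,a,b] →ₐ[ℚ] Matrix (Fin 2) (Fin 2) ℝ :=
    (E.toRingEquiv.toRingHom.comp
      (Algebra.TensorProduct.includeRight : ℍ[ℚ,a,b] →ₐ[ℚ] ℝ ⊗[ℚ] ℍ[ℚ,a,b]).toRingHom).toRatAlgHom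
  have hι : ∀ x, ι x = E ((1 : ℝ) ⊗ₜ[ℚ] x) := fun _ => rfl
  haveI := IsQuaternionAlgebra.isSimpleRing' ℚ ℍ[ℚ,a,b]
  have hιinj : Function.Injective ι := RingHom.injective ι.toRingHom
  obtain ⟨F, hF⟩ := exists_isHypFundamentalDomain_of_isDiscreteSubgroup
    (normOneUnits_le_range_toGL ι hEich.isOrder)
    (isDiscreteSubgroup_normOneUnits_of_realSplitting E ι hι hEich.isOrder)
  -- the datum
  let X : ShimuraCurveData (disc B) 1 :=
    { B := ℍ[ℚ,a,b]
      squarefree := hsq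
      ramifiedPlaces_eq := hram
      O := O₀
      isEichlerOrder := hEich
      ι := ι
      ι_injective := hιinj
      fd := F
      isFundamentalDomain_fd := hF }
  have hdiv : ∀ x : ℍ[ℚ,a,b], x ≠ 0 → IsUnit x := fun x hx => X.isUnit_of_ne_zero hD x hx
  -- step 2 in the model: `e y` lies in a maximal order `O₁`
  have hy₀ : e y * e y = algebraMap ℚ ℍ[ℚ,a,b] ((-(disc B : ℤ) : ℤ) : ℚ) := by
    rw [← map_mul, hy, AlgEquiv.commutes]
    push_cast
    rfl
  obtain ⟨O₁, hO₁, hyO₁⟩ := exists_isMaximalOrder_mem_of_mul_self_eq hdiv hEich.isOrder hy₀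
    (neg_ne_zero.2 (by exact_mod_cast disc_ne_zero B))
  have hO₁E : Brandt.IsEichlerOrder ℍ[ℚ,a,b] O₁ 1 :=
    ⟨O₁, O₁, hO₁, hO₁, (inf_idem O₁).symm, AddSubgroup.relIndex_self _⟩
  -- step 3: `O₁ = β O₀ β⁻¹`
  obtain ⟨β, hβ⟩ := exists_forall_mem_iff_conj_mem_of_shimuraCurveData X hD one_pos hO₁E
  have hδ : ((β⁻¹ : (ℍ[ℚ,a,b])ˣ) : ℍ[ℚ,a,b]) * e y * β ∈ O₀ := (hβ (e y)).1 hyO₁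
  refine exists_delta_of_algEquiv e hδ ?_
  have h1 : ((β⁻¹ : (ℍ[ℚ,a,b])ˣ) : ℍ[ℚ,a,b]) * e y * β * (((β⁻¹ : (ℍ[ℚ,a,b])ˣ) : ℍ[ℚ,a,b]) * e y * β) =
      ((β⁻¹ : (ℍ[ℚ,a,b])ˣ) : ℍ[ℚ,a,b]) * (e y * e y) * β := by
    simp only [mul_assoc, Units.mul_inv_cancel_left]
  rw [h1, ← map_mul, hy, AlgEquiv.commutes, mul_assoc, Algebra.commutes, Units.inv_mul_cancel_left]

/-! ### `D(B) = 1`: maximal orders of `M₂(ℚ)` -/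

/-- **`D(B) = 1`**: for `B` an indefinite quaternion algebra over `ℚ` with `D(B) = 1` and `O_B` maximal, `B ≃ M₂(ℚ)`
(Vignéras III §3 Thm. 3.1), `O_B ↦ g M₂(ℤ) g⁻¹` (II §2 Lemme 2.1), and `δ = g·((0, -1), (1, 0))·g⁻¹ ∈ O_B` has
`δ² = -1 = -D(B)`. [cite: KudlaRapoportYang2006, §3.4 Remark 3.4.7 (p. 55)] [cite: VignerasLNM800, Ch. II §2 Lemme 2.1 and Ch. III §3 Thm. 3.1] -/
theorem exists_delta_of_not_one_lt_disc {B : Type u} [Ring B] [Algebra ℚ B] [IsQuaternionAlgebra ℚ B]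
    (hind : IsIndefinite B) {O : Submodule ℤ B} (hmax : Brandt.IsMaximalOrder B O) (hD : ¬ 1 < disc B) :
    ∃ δ ∈ O, δ * δ = algebraMap ℚ B (-(disc B : ℚ)) := by
  classical
  have hD1 : disc B = 1 := by
    have h0 := disc_ne_zero B
    omega
  -- `B ≃ M₂(ℚ)`
  have hempty : ramifiedPrimes B = ∅ := by
    rwa [one_lt_disc_iff, Set.not_nonempty_iff_eq_empty] at hD
  have hf : ramifiedPlaces ℚ B = ramifiedPlaces ℚ (Matrix (Fin 2) (Fin 2) ℚ) := by
    rw [ramifiedPlaces_matrix]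
    refine Set.eq_empty_of_forall_notMem fun v hv => ?_
    haveI : Fact (((Rat.HeightOneSpectrum.primesEquiv v : Nat.Primes) : ℕ)).Prime :=
      ⟨(Rat.HeightOneSpectrum.primesEquiv v).2⟩
    have hmem : ((Rat.HeightOneSpectrum.primesEquiv v : Nat.Primes) : ℕ) ∈ ramifiedPrimes B :=
      (mem_ramifiedPrimes_iff B _).mpr (isDivisionAt_of_not_isSplitAt B v hv _ rfl)
    rw [hempty] at hmem
    exact hmem
  obtain ⟨e'⟩ := hind
  let ι : B →ₐ[ℚ] Matrix (Fin 2) (Fin 2) ℝ :=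
    (e'.restrictScalars ℚ).toAlgHom.comp (ScalarExtension.incl ℚ ℝ B)
  have hi : ramifiedInfinitePlaces ℚ B = ramifiedInfinitePlaces ℚ (Matrix (Fin 2) (Fin 2) ℚ) := by
    rw [ramifiedInfinitePlaces_eq_empty_of_algHom_real ι, ramifiedInfinitePlaces_matrix]
  haveI : IsQuaternionAlgebra ℚ (Matrix (Fin 2) (Fin 2) ℚ) := isQuaternionAlgebra_matrix ℚ
  obtain ⟨e⟩ := nonempty_algEquiv_of_ramifiedPlaces_eq_holds ℚ B (Matrix (Fin 2) (Fin 2) ℚ) hf hi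
  -- the transported maximal order is `g M₂(ℤ) g⁻¹`
  have hmax₁ := hmax.map_ringEquiv (e : B ≃+* Matrix (Fin 2) (Fin 2) ℚ)
  obtain ⟨g, hg⟩ := hmax₁.exists_eq_map_unitsConj_matrixOrder
  -- `δ = g·J·g⁻¹`, `J = ((0, -1), (1, 0))`
  obtain ⟨J, hJ⟩ : ∃ J : Matrix (Fin 2) (Fin 2) ℚ, J = !![0, -1; 1, 0] := ⟨_, rfl⟩
  have hJZ : J ∈ (matrixOrder ℤ ℚ : Submodule ℤ (Matrix (Fin 2) (Fin 2) ℚ)) := by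
    rw [mem_matrixOrder_iff_exists_intCast]
    intro i j
    fin_cases i <;> fin_cases j
    · exact ⟨0, by simp [hJ]⟩
    · exact ⟨-1, by simp [hJ]⟩
    · exact ⟨1, by simp [hJ]⟩
    · exact ⟨0, by simp [hJ]⟩
  have hJJ : J * J = -1 := by
    rw [hJ]
    ext i j
    fin_cases i <;> fin_cases j <;> simp [Matrix.mul_apply, Fin.sum_univ_two]
  obtain ⟨z, hz⟩ : ∃ z : Matrix (Fin 2) (Fin 2) ℚ,
      z = (g : Matrix (Fin 2) (Fin 2) ℚ) * J * ((g⁻¹ : (Matrix (Fin 2) (Fin 2) ℚ)ˣ) : Matrix (Fin 2) (Fin 2) ℚ) :=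
    ⟨_, rfl⟩
  have hzO : z ∈ O.map ((e : B ≃+* Matrix (Fin 2) (Fin 2) ℚ).toAddEquiv.toIntLinearEquiv :
      B →ₗ[ℤ] Matrix (Fin 2) (Fin 2) ℚ) := by
    rw [hg, mem_map_unitsConj_iff, hz, ← mul_assoc, ← mul_assoc, Units.inv_mul, one_mul, mul_assoc, Units.inv_mul,
      mul_one]
    exact hJZ
  have hzz : z * z = algebraMap ℚ (Matrix (Fin 2) (Fin 2) ℚ) (-(disc B : ℚ)) := by
    rw [hD1, Nat.cast_one, map_neg, map_one]
    calc z * z = (g : Matrix (Fin 2) (Fin 2) ℚ) *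
          (J * ((((g⁻¹ : (Matrix (Fin 2) (Fin 2) ℚ)ˣ) : Matrix (Fin 2) (Fin 2) ℚ) *
            (g : Matrix (Fin 2) (Fin 2) ℚ)) * J)) * ((g⁻¹ : (Matrix (Fin 2) (Fin 2) ℚ)ˣ) : Matrix (Fin 2) (Fin 2) ℚ) := by
          simp only [hz, mul_assoc]
      _ = -1 := by rw [Units.inv_mul, one_mul, hJJ, mul_neg, mul_one, neg_mul, Units.mul_inv]
  exact exists_delta_of_algEquiv e hzO hzz

/-! ### Assembly -/

variable (B : Type u) [Ring B] [Algebra ℚ B] (O : Submodule ℤ B)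

/-- ★ `KRY2006_3_4_7_exists_delta` HOLDS. [KudlaRapoportYang2006, §3.4 Remark 3.4.7 (p. 55)]: «Recall that there is an element
`δ ∈ O_B` such that `δ² = -D(B)`» — for `B` an indefinite quaternion algebra over `ℚ` and `O_B` a maximal order: `ℚ(√-D(B))`
embeds in `B` (Vignéras III §3 Thm. 3.8), an embedded `√-D(B)` lies in a maximal order (I §4 Prop. 4.2), and all maximal
orders of `B` are conjugate (Eichler, III §5 Thm. 5.7; for `D(B) = 1` directly `O_B ≃ M₂(ℤ)`).
[cite: KudlaRapoportYang2006, §3.4 Remark 3.4.7 (p. 55)] [cite: VignerasLNM800, Ch. III §3 Thm. 3.8 and §5 Thm. 5.7] -/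
theorem KRY2006_3_4_7_exists_delta_holds : KRY2006_3_4_7_exists_delta B O := by
  intro _ hind hmax
  by_cases hD : 1 < disc B
  · exact exists_delta_of_one_lt_disc hind hmax hD
  · exact exists_delta_of_not_one_lt_disc hind hmax hD

end Literature.AlgebraicGeometry.ShimuraVarieties.KudlaRapoportYang2006.Ch3CyclesShimuraCurvesI

end
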